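import Mathlib
import HarnessLib
import Summits.PneNP.PneNP.Theorems.CnfIdealGenLengthRankCount
import Summits.PneNP.PneNP.Theorems.CnfIdealGenLengthRankDefectRepresentationsTseitinTransferCnf
import Summits.PneNP.PneNP.Theorems.CnfIdealGenLengthRankDefectRepresentationsTseitinTransferRank

/-!
# Crux `RankDefectRepresentations` (stmt-PneNP-18923), line `rank-dehn-ladder`: the registered stub `stub_tseitinTransfer`

BOOLEAN-CERTIFICATE TRANSFER IN THE RANK METRIC (exponent `a = 5`).  For an almost-representation `M` on `n` letters over a
field `K` (every Boolean/commutator axiom of rank `≤ t` under `M`) and a propositional tautology `T` with `n + size T ≤ N`: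
the Tseitin CNF `φ` of `T` on `Fin N` [Tseitin1968] is unsatisfiable with `numClauses, size ≤ (N+2)^5`; the tuple
`M' = extTuple K M T N` (letters of `M`, then the truth-value matrices `Y(g) = 1 - tr(g)(M)` of the subformulas of `T` in
preorder, then `0`) is an almost-representation with defect `N² t` (`rank_defect_tv_le`, `rank_comm_tv_tv_le`); and
evaluating the clause product gives `P_φ(M') = U · tr(T)(M)` where `U = prod_κ (1 - Q_κ(M'))` runs over the node clauses,
each clause word having rank `≤ 3 (size T)² t` (`rank_nodeClause_le`: a node clause word is `Y (1-Y₁)`,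
`(1 - Y₁ Y₂) Y₁ Y₂`, …, small by almost-idempotency and almost-centrality), so `rank (1 - U) ≤ 9 N³ t` and
`rank tr(T)(M) ≤ rank P_φ(M') + 9 N³ t ≤ (N+2)^5 (rank P_φ(M') + t)`.
The theorem `stub_tseitinTransfer` has EXACTLY the signature registered for the skeleton `Lines/rank_dehn_ladder.lean`.
HONEST FRAMING: one rung of the ladder (the transfer step) is now kernel-checked; the cut lemma, the instability stubs, the
crux `RankDefectRepresentations`, `GL_noncomm` and P ≠ NP are NOT touched; F-N2 is a FRONTIER formal rung.
-/

set_option linter.dupNamespace false -- `Summit.PneNP.PneNP.…`: summit = sub-problem name (D-0017)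

namespace Summit.PneNP.PneNP.Theorems.CnfIdealGenLengthRankDefectRepresentationsTseitinTransfer

open Literature.Computability.Complexity
open Literature.Computability.MetaComplexity
open Literature.Computability.MetaComplexity.NCIPS

/-! ## The transfer: clause words of the Tseitin CNF and the registered stub -/

section Transfer

variable {K : Type} [Field K] {n d : ℕ}

/-- **Clause words of the Tseitin clauses have small rank.** Let `e : ℕ → Matrix (Fin d) (Fin d) K` be an environment
reading the original
letters from `M` and the node `n + k + j` of `g` (numbered from `n + k`) as the truth-value matrix of the subformula at
position `j`. Then every Tseitin clause word of `g` evaluates under `e` to a matrix of rank `≤ 3 s² t`, where `s ≥ size g`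
and `t` bounds the Boolean and commutator defects of `M`. [cite: Tseitin1968, §1] -/
theorem rank_nodeClause_le (M : Fin n → Matrix (Fin d) (Fin d) K) (t : ℕ) (hB : ∀ i, (M i * M i - M i).rank ≤ t)
    (hC : ∀ i j, (M i * M j - M j * M i).rank ≤ t) (e : ℕ → Matrix (Fin d) (Fin d) K) (he : ∀ i : Fin n, e i = M i) (s : ℕ) :
    ∀ (g : PropForm (Fin n)) (k : ℕ), g.size ≤ s →
      (∀ (j : ℕ) (g' : PropForm (Fin n)), subAt g j = some g' →
        e (n + (k + j)) = 1 - MonoidAlgebra.lift K (Matrix (Fin d) (Fin d) K) (FreeMonoid (Fin n)) (FreeMonoid.lift M) (tr K g')) →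
      ∀ κ ∈ tseitinClauses n g k,
        ((κ.map fun l : Literal ℕ => if l.2 then 1 - e l.1 else e l.1).prod).rank ≤ 3 * (s ^ 2 * t)
  | .var i, k, hs, H, κ, hκ => by
      have hp := H 0 (.var i) (subAt_zero _)
      rw [Nat.add_zero, tv_var] at hp
      have hi := he i
      have hts : t ≤ s ^ 2 * t := Nat.le_mul_of_pos_left t (by simp only [PropForm.size] at hs; positivity)
      have hd := hB i
      simp [tseitinClauses] at hκ
      rcases hκ with rfl | rfl
      · simp only [List.map_cons, List.map_nil, List.prod_cons, List.prod_nil, mul_one, Bool.false_eq_true,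
          if_false, if_true, hp, hi, rk_shape_a_na]
        omega
      · simp only [List.map_cons, List.map_nil, List.prod_cons, List.prod_nil, mul_one, Bool.false_eq_true,
          if_false, if_true, hp, hi, rk_shape_na_a]
        omega
  | .const b, k, hs, H, κ, hκ => by
      have hp := H 0 (.const b) (subAt_zero _)
      rw [Nat.add_zero, tv_const] at hp
      cases b
      · simp [tseitinClauses] at hκ; subst hκ; simp [hp]
      · simp [tseitinClauses] at hκ; subst hκ; simp [hp]
  | .neg g, k, hs, H, κ, hκ => by
      have hp := H 0 (.neg g) (subAt_zero _)
      rw [Nat.add_zero, tv_neg] at hp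
      have hsg : g.size ≤ s := by simp only [PropForm.size] at hs; omega
      have h1 := H 1 g (by rw [subAt_neg_succ, subAt_zero])
      have hd : ((1 - MonoidAlgebra.lift K (Matrix (Fin d) (Fin d) K) (FreeMonoid (Fin n)) (FreeMonoid.lift M) (tr K g)) *
            (1 - MonoidAlgebra.lift K (Matrix (Fin d) (Fin d) K) (FreeMonoid (Fin n)) (FreeMonoid.lift M) (tr K g)) -
          (1 - MonoidAlgebra.lift K (Matrix (Fin d) (Fin d) K) (FreeMonoid (Fin n)) (FreeMonoid.lift M) (tr K g))).rank ≤ s ^ 2 * t :=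
        (rank_defect_tv_le M t hB hC g).trans (sq_mul_le_sq_mul hsg)
      have hs3 : s ^ 2 * t ≤ 3 * (s ^ 2 * t) := by omega
      simp [tseitinClauses] at hκ
      rcases hκ with rfl | rfl | hκ
      · simp only [List.map_cons, List.map_nil, List.prod_cons, List.prod_nil, mul_one, Bool.false_eq_true,
          if_false, hp, h1, rk_shape_na_a]
        omega
      · simp only [List.map_cons, List.map_nil, List.prod_cons, List.prod_nil, mul_one, if_true, hp, h1,
          rk_shape_nna_na]
        omega
      · exact rank_nodeClause_le M t hB hC e he s g (k + 1) hsg (fun j g' hj => by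
          have := H (j + 1) g' (by rw [subAt_neg_succ]; exact hj)
          rwa [show k + (j + 1) = k + 1 + j by omega] at this) κ hκ
  | .conj a b, k, hs, H, κ, hκ => by
      have hp := H 0 (.conj a b) (subAt_zero _)
      rw [Nat.add_zero, tv_conj] at hp
      have hsa : a.size ≤ s := by simp only [PropForm.size] at hs; omega
      have hsb : b.size ≤ s := by simp only [PropForm.size] at hs; omega
      have h1 := H 1 a (by rw [subAt_conj_succ, if_pos (PropForm.size_pos a), subAt_zero])
      have h2 : e (n + (k + 1 + a.size)) =
          1 - MonoidAlgebra.lift K (Matrix (Fin d) (Fin d) K) (FreeMonoid (Fin n)) (FreeMonoid.lift M) (tr K b) := by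
        have := H (a.size + 1) b (by rw [subAt_conj_succ, if_neg (lt_irrefl _), Nat.sub_self, subAt_zero])
        rwa [show k + (a.size + 1) = k + 1 + a.size by omega] at this
      have hda := (rank_defect_tv_le M t hB hC a).trans (sq_mul_le_sq_mul (t := t) hsa)
      have hdb := (rank_defect_tv_le M t hB hC b).trans (sq_mul_le_sq_mul (t := t) hsb)
      have hcm := (rank_comm_tv_tv_le M t hC a b).trans (mul_mul_le_sq_mul (t := t) hsa hsb)
      simp [tseitinClauses] at hκ
      rcases hκ with rfl | rfl | rfl | hκ | hκ
      · simp only [List.map_cons, List.map_nil, List.prod_cons, List.prod_nil, mul_one, Bool.false_eq_true,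
          if_false, if_true, hp, h1]
        exact (rk_shape_pqnp _ _).trans (by omega)
      · simp only [List.map_cons, List.map_nil, List.prod_cons, List.prod_nil, mul_one, Bool.false_eq_true,
          if_false, if_true, hp, h2]
        exact (rk_shape_pqnq _ _).trans (by omega)
      · simp only [List.map_cons, List.map_nil, List.prod_cons, List.prod_nil, mul_one, Bool.false_eq_true,
          if_false, if_true, hp, h1, h2]
        exact (rk_shape_npq_pq _ _).trans (by omega)
      · exact rank_nodeClause_le M t hB hC e he s a (k + 1) hsa (fun j g' hj => by
          have := H (j + 1) g' (by rw [subAt_conj_succ, if_pos (lt_size_of_subAt a j g' hj)]; exact hj)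
          rwa [show k + (j + 1) = k + 1 + j by omega] at this) κ hκ
      · exact rank_nodeClause_le M t hB hC e he s b (k + 1 + a.size) hsb (fun j g' hj => by
          have := H (j + a.size + 1) g' (by
            rw [subAt_conj_succ, if_neg (by omega), Nat.add_sub_cancel]; exact hj)
          rwa [show k + (j + a.size + 1) = k + 1 + a.size + j by omega] at this) κ hκ
  | .disj a b, k, hs, H, κ, hκ => by
      have hp := H 0 (.disj a b) (subAt_zero _)
      rw [Nat.add_zero, tv_disj] at hp
      have hsa : a.size ≤ s := by simp only [PropForm.size] at hs; omega
      have hsb : b.size ≤ s := by simp only [PropForm.size] at hs; omega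
      have h1 := H 1 a (by rw [subAt_disj_succ, if_pos (PropForm.size_pos a), subAt_zero])
      have h2 : e (n + (k + 1 + a.size)) =
          1 - MonoidAlgebra.lift K (Matrix (Fin d) (Fin d) K) (FreeMonoid (Fin n)) (FreeMonoid.lift M) (tr K b) := by
        have := H (a.size + 1) b (by rw [subAt_disj_succ, if_neg (lt_irrefl _), Nat.sub_self, subAt_zero])
        rwa [show k + (a.size + 1) = k + 1 + a.size by omega] at this
      have hda := (rank_defect_tv_le M t hB hC a).trans (sq_mul_le_sq_mul (t := t) hsa)
      have hdb := (rank_defect_tv_le M t hB hC b).trans (sq_mul_le_sq_mul (t := t) hsb)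
      have hcm := (rank_comm_tv_tv_le M t hC a b).trans (mul_mul_le_sq_mul (t := t) hsa hsb)
      simp [tseitinClauses] at hκ
      rcases hκ with rfl | rfl | rfl | hκ | hκ
      · simp only [List.map_cons, List.map_nil, List.prod_cons, List.prod_nil, mul_one, Bool.false_eq_true,
          if_false, if_true, hp, h1, h2]
        exact (rk_shape_disj1 _ _).trans (by omega)
      · simp only [List.map_cons, List.map_nil, List.prod_cons, List.prod_nil, mul_one, Bool.false_eq_true,
          if_false, if_true, hp, h1]
        exact (rk_shape_disj2 _ _).trans (by omega)
      · simp only [List.map_cons, List.map_nil, List.prod_cons, List.prod_nil, mul_one, Bool.false_eq_true,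
          if_false, if_true, hp, h2]
        exact (rk_shape_disj3 _ _).trans (by omega)
      · exact rank_nodeClause_le M t hB hC e he s a (k + 1) hsa (fun j g' hj => by
          have := H (j + 1) g' (by rw [subAt_disj_succ, if_pos (lt_size_of_subAt a j g' hj)]; exact hj)
          rwa [show k + (j + 1) = k + 1 + j by omega] at this) κ hκ
      · exact rank_nodeClause_le M t hB hC e he s b (k + 1 + a.size) hsb (fun j g' hj => by
          have := H (j + a.size + 1) g' (by
            rw [subAt_disj_succ, if_neg (by omega), Nat.add_sub_cancel]; exact hj)
          rwa [show k + (j + a.size + 1) = k + 1 + a.size + j by omega] at this) κ hκ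

/-- Every coordinate of the extended tuple is the truth-value matrix of a formula of size `≤ size T`
(a letter `x_i`, a subformula of `T`, or the constant `false` past the end). [folklore] -/
theorem extNat_eq_tv (M : Fin n → Matrix (Fin d) (Fin d) K) (T : PropForm (Fin n)) (m : ℕ) :
    ∃ g : PropForm (Fin n), g.size ≤ T.size ∧
      extNat K M T m = 1 - MonoidAlgebra.lift K (Matrix (Fin d) (Fin d) K) (FreeMonoid (Fin n)) (FreeMonoid.lift M) (tr K g) := by
  have hT := PropForm.size_pos T
  unfold extNat
  by_cases h : m < n
  · refine ⟨.var ⟨m, h⟩, by simp only [PropForm.size]; omega, ?_⟩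
    rw [dif_pos h, tv_var]
  · rw [dif_neg h]
    cases hq : subAt T (m - n) with
    | none =>
        refine ⟨.const false, by simp only [PropForm.size]; omega, ?_⟩
        rw [tv_const]; simp [nodeMat, hq]
    | some g => exact ⟨g, size_le_of_subAt T _ g hq, by simp [nodeMat, hq]⟩

/-- Abstract assembly of the final inequality: if `rank (W x) ≤ 3 s² t` for the `≤ 3 s` factors of
`U = ∏ (1 - W x)` and `s ≤ N`, then `rank A ≤ (N+2)^5 · (rank (U A) + t)`. [folklore] -/
theorem rank_le_pow_mul_of_prod {ι : Type*} (l : List ι) (W : ι → Matrix (Fin d) (Fin d) K) (A : Matrix (Fin d) (Fin d) K)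
    (s t N : ℕ) (hs : s ≤ N)
    (hl : l.length ≤ 3 * s) (hW : ∀ x ∈ l, (W x).rank ≤ 3 * (s ^ 2 * t)) :
    A.rank ≤ (N + 2) ^ 5 * (((l.map fun x => 1 - W x).prod * A).rank + t) := by
  have h1 := rk_le_rank_mul_add (l.map fun x => 1 - W x).prod A
  have h2 := rk_one_sub_prod_map_le W (3 * (s ^ 2 * t)) l hW
  have hLB : l.length * (3 * (s ^ 2 * t)) ≤ 9 * N ^ 3 * t :=
    calc l.length * (3 * (s ^ 2 * t)) ≤ (3 * s) * (3 * (s ^ 2 * t)) := Nat.mul_le_mul_right _ hl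
      _ = 9 * s ^ 3 * t := by ring
      _ ≤ 9 * N ^ 3 * t := Nat.mul_le_mul_right t (Nat.mul_le_mul_left 9 (Nat.pow_le_pow_left hs 3))
  have h95 : 9 * N ^ 3 ≤ (N + 2) ^ 5 := by ring_nf; omega
  have hpos : 0 < (N + 2) ^ 5 := by positivity
  calc A.rank ≤ ((l.map fun x => 1 - W x).prod * A).rank + 9 * N ^ 3 * t := by omega
    _ ≤ (N + 2) ^ 5 * ((l.map fun x => 1 - W x).prod * A).rank + (N + 2) ^ 5 * t :=
        Nat.add_le_add (Nat.le_mul_of_pos_left _ hpos) (Nat.mul_le_mul_right t h95)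
    _ = (N + 2) ^ 5 * (((l.map fun x => 1 - W x).prod * A).rank + t) := by rw [Nat.mul_add]

/-- Polynomial bookkeeping for the exponent `a = 5`. [folklore] -/
theorem poly_bounds (N : ℕ) :
    3 * N + 1 ≤ (N + 2) ^ 5 ∧ 3 * (3 * N + 1) ≤ (N + 2) ^ 5 ∧ N ^ 2 ≤ (N + 2) ^ 5 := by
  refine ⟨?_, ?_, ?_⟩ <;> ring_nf <;> omega

end Transfer


section Stub

/-- **Registered stub `stub_tseitinTransfer`** of the line `rank-dehn-ladder` for the crux `RankDefectRepresentations`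
(stmt-PneNP-18923): Boolean-certificate transfer in the rank metric, with exponent `a = 5`.  Given an almost-representation
`M` (axiom ranks `≤ t`) on `n` letters and a tautology `T` with `n + size T ≤ N`, the Tseitin CNF `φ` of `T` on `Fin N`
[Tseitin1968] is unsatisfiable with `≤ (N+2)^5` clauses and size, the tuple `M'` extending `M` by the truth-value matrices of
the subformulas of `T` is an almost-representation with `t' = N² t`, and `P_φ(M') = U · tr(T)(M)` with
`rank (1 - U) ≤ 9 N³ t`, whence `rank tr(T)(M) ≤ (N+2)^5 (rank P_φ(M') + t)`.
HONEST FRAMING: one rung of the ladder skeleton (the transfer step); the crux, GL_noncomm and P ≠ NP are NOT touched; F-N2 is a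
FRONTIER formal rung. [cite: Tseitin1968, §1; LiTzameretWang2018, Def. 1.3] -/
theorem stub_tseitinTransfer : ∃ a : ℕ, ∀ (n N : ℕ) (K : Type) [Field K] [CharZero K] (d t : ℕ)
    (M : Fin n → Matrix (Fin d) (Fin d) K) (T : PropForm (Fin n)), T.IsTautology →
    (∀ g : MonoidAlgebra K (FreeMonoid (Fin n)), IsAxiom g →
      (MonoidAlgebra.lift K (Matrix (Fin d) (Fin d) K) (FreeMonoid (Fin n)) (FreeMonoid.lift M) g).rank ≤ t) →
    n + T.size ≤ N →
    ∃ φ : CNF (Fin N), ¬ φ.Satisfiable ∧ φ.numClauses ≤ (N + 2) ^ a ∧ φ.size ≤ (N + 2) ^ a ∧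
      ∃ (d' t' : ℕ) (M' : Fin N → Matrix (Fin d') (Fin d') K),
        (∀ g : MonoidAlgebra K (FreeMonoid (Fin N)), IsAxiom g →
          (MonoidAlgebra.lift K (Matrix (Fin d') (Fin d') K) (FreeMonoid (Fin N)) (FreeMonoid.lift M') g).rank
            ≤ t') ∧
        t' ≤ (N + 2) ^ a * t ∧
        (MonoidAlgebra.lift K (Matrix (Fin d) (Fin d) K) (FreeMonoid (Fin n)) (FreeMonoid.lift M) (tr K T)).rank
          ≤ (N + 2) ^ a * ((MonoidAlgebra.lift K (Matrix (Fin d') (Fin d') K) (FreeMonoid (Fin N))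
              (FreeMonoid.lift M') (clauseProduct K φ)).rank + t) := by
  refine ⟨5, ?_⟩
  intro n N K _ _ d t M T hT hM hN
  have hT1 := PropForm.size_pos T
  have hN0 : 0 < N := by omega
  have hTN : T.size ≤ N := by omega
  have hnN : n < N := by omega
  have hpoly := poly_bounds N
  have hB : ∀ i, (M i * M i - M i).rank ≤ t := fun i => by
    have := hM _ (Or.inl ⟨i, rfl⟩)
    rwa [map_sub, map_mul, lift_X_eq] at this
  have hC : ∀ i j, (M i * M j - M j * M i).rank ≤ t := fun i j => by
    by_cases hij : i = j
    · subst hij; simp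
    · have := hM _ (Or.inr ⟨i, j, hij, rfl⟩)
      rwa [map_sub, map_mul, map_mul, lift_X_eq, lift_X_eq] at this
  refine ⟨tseitinCNF n N hN0 T, not_satisfiable_tseitinCNF hN0 hT,
    (numClauses_tseitinCNF_le hN0 T).trans (by omega), (size_tseitinCNF_le hN0 T).trans (by omega),
    d, N ^ 2 * t, extTuple K M T N, ?_, Nat.mul_le_mul_right t hpoly.2.2, ?_⟩
  · -- `M'` is an almost-representation with defect `N² t`
    intro g hg
    rcases hg with ⟨v, rfl⟩ | ⟨v, w, _, rfl⟩
    · rw [map_sub, map_mul, lift_X_eq]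
      obtain ⟨g, hgs, hE⟩ := extNat_eq_tv M T v.val
      rw [show extTuple K M T N v = extNat K M T v.val from rfl, hE]
      exact (rank_defect_tv_le M t hB hC g).trans (sq_mul_le_sq_mul (hgs.trans hTN))
    · rw [map_sub, map_mul, map_mul, lift_X_eq, lift_X_eq]
      obtain ⟨g, hgs, hE⟩ := extNat_eq_tv M T v.val
      obtain ⟨h, hhs, hF⟩ := extNat_eq_tv M T w.val
      rw [show extTuple K M T N v = extNat K M T v.val from rfl,
        show extTuple K M T N w = extNat K M T w.val from rfl, hE, hF]
      exact (rank_comm_tv_tv_le M t hC h g).trans (mul_mul_le_sq_mul (hhs.trans hTN) (hgs.trans hTN))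
  · -- the main inequality: `P_φ(M') = U · tr(T)(M)` and `rank (1 - U) ≤ 9 N³ t`
    set e : ℕ → Matrix (Fin d) (Fin d) K := fun m => extNat K M T (m % N) with he_def
    have he_app : ∀ m, e m = extNat K M T (m % N) := fun m => rfl
    have he : ∀ i : Fin n, e i = M i := fun i => by
      rw [he_app, Nat.mod_eq_of_lt (by omega)]; exact extNat_lt K M T i
    have hH : ∀ (j : ℕ) (g' : PropForm (Fin n)), subAt T j = some g' →
        e (n + (0 + j)) = 1 - MonoidAlgebra.lift K (Matrix (Fin d) (Fin d) K) (FreeMonoid (Fin n))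
          (FreeMonoid.lift M) (tr K g') := fun j g' hj => by
      have := lt_size_of_subAt T j g' hj
      rw [Nat.zero_add, he_app, Nat.mod_eq_of_lt (by omega), extNat_node]
      simp [nodeMat, hj]
    have hcl := rank_nodeClause_le M t hB hC e he T.size T 0 le_rfl hH
    have hP : MonoidAlgebra.lift K (Matrix (Fin d) (Fin d) K) (FreeMonoid (Fin N)) (FreeMonoid.lift (extTuple K M T N))
          (clauseProduct K (tseitinCNF n N hN0 T)) =
        ((tseitinClauses n T 0).map fun κ =>
            1 - (κ.map fun l : Literal ℕ => if l.2 then 1 - e l.1 else e l.1).prod).prod *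
          MonoidAlgebra.lift K (Matrix (Fin d) (Fin d) K) (FreeMonoid (Fin n)) (FreeMonoid.lift M) (tr K T) := by
      rw [Summit.PneNP.PneNP.Theorems.CnfIdealGenLength.lift_clauseProduct]
      simp only [tseitinCNF, tseitinNat, List.map_append, List.map_map, Function.comp_def, List.map_cons,
        List.map_nil, List.prod_append, List.prod_cons, List.prod_nil, mul_one, FreeMonoid.lift_eval_of,
        Bool.false_eq_true, if_false, extTuple]
      congr 1
      have h0 : extNat K M T n = nodeMat K M T 0 := extNat_node K M T 0
      rw [Nat.mod_eq_of_lt hnN, h0]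
      simp [nodeMat]
    rw [hP]
    exact rank_le_pow_mul_of_prod (tseitinClauses n T 0) _ _ T.size t N hTN (length_tseitinClauses_le T 0) hcl

end Stub


end Summit.PneNP.PneNP.Theorems.CnfIdealGenLengthRankDefectRepresentationsTseitinTransfer
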